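import Mathlib
import Literature.Analysis.ODE.InverseSquareLadder
import HarnessLib

/-!
# The Darboux ladder on polynomials: `ladder n` of a Taylor polynomial is a combination of `x^{2j−n}`

Analysis/ODE support file (everything proved). With `ι = x⁻¹` on `(½, ∞)` the rung
`ladderStep ι k f = f' − (k/x) f` maps `x^m ↦ (m − k) x^{m−1}`... composed along the ladder,
`ladder ι k (x^m) = Π_{l<k} (m − 2l − 1) · x^{m−k}` (`ladder_powerSum`, stated for finite power
sums `Σ e_m x^m` with real-power output). The coefficient `Π_{l<n}(m − 2l − 1)` vanishes for odd
`m ≤ 2n − 1`; hence for a polynomial of degree `≤ N ≤ n` — in particular a Taylor polynomial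
`Σ_{m≤N} d_m (x−1)^m` — `ladder ι n` of it is, on `(½, ∞)`, a combination `Σ_{m≤N} α_m x^{m−n}`
with `α_m = 0` for odd `m` (`ladder_taylorSum_eq_powerSum`): exactly a combination of the data
`x^{2j−n}` of the non-radiative `t`-polynomial solutions of `ψ_tt − ψ_xx + n(n+1)x⁻²ψ = 0`. This
identifies the comparison data in the exact-potential channel estimate
(`InverseSquareChannelEstimate.lean`) with the span of the kernel data (route PhotonSphereChannels,
`FixedModeChannels`, far side, stmt-FinalStateConjecture-10048; Kenig–Lawrie–Liu–Schlag 2015 §2).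
Folklore.
-/

noncomputable section

namespace Literature.Analysis.ODE

open Set Filter Topology Finset Real Polynomial

variable {ι : ℝ → ℝ}

/-- **The ladder of a power sum.** For `ι = x⁻¹` on `(½,∞)`:
`ladder ι k (Σ_{m≤N} e_m x^m) = Σ_{m≤N} e_m Π_{l<k}(m − 2l − 1) x^{m−k}` there. [folklore] -/
theorem ladder_powerSum (hιeq : ∀ x, 1 / 2 < x → ι x = x⁻¹) (e : ℕ → ℝ) (N : ℕ) :
    ∀ k : ℕ, ∀ x, 1 / 2 < x →
      ladder ι k (fun z => ∑ m ∈ range (N + 1), e m * z ^ m) x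
        = ∑ m ∈ range (N + 1), e m * (∏ l ∈ range k, ((m : ℝ) - 2 * l - 1)) * x ^ ((m : ℝ) - k) := by
  intro k
  induction k with
  | zero =>
    intro x hx
    simp only [ladder_zero, Finset.prod_range_zero, mul_one, Nat.cast_zero, sub_zero, rpow_natCast]
  | succ k ih =>
    intro x hx
    have hx0 : 0 < x := by linarith
    rw [ladder_succ, ladderStep_apply]
    -- the derivative of the previous rung, computed on the open set `(½, ∞)`
    have hloc : ladder ι k (fun z => ∑ m ∈ range (N + 1), e m * z ^ m) =ᶠ[𝓝 x]
        fun y => ∑ m ∈ range (N + 1), e m * (∏ l ∈ range k, ((m : ℝ) - 2 * l - 1))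
          * y ^ ((m : ℝ) - k) :=
      Filter.mem_of_superset (Ioi_mem_nhds hx) fun y hy => ih y hy
    have hder : HasDerivAt (fun y => ∑ m ∈ range (N + 1),
        e m * (∏ l ∈ range k, ((m : ℝ) - 2 * l - 1)) * y ^ ((m : ℝ) - k))
        (∑ m ∈ range (N + 1), e m * (∏ l ∈ range k, ((m : ℝ) - 2 * l - 1))
          * (((m : ℝ) - k) * x ^ ((m : ℝ) - k - 1))) x :=
      HasDerivAt.fun_sum fun m _ =>
        (Real.hasDerivAt_rpow_const (p := (m : ℝ) - k) (Or.inl hx0.ne')).const_mul _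
    rw [(hder.congr_of_eventuallyEq hloc).deriv, ih x hx, hιeq x hx, Finset.mul_sum,
      ← Finset.sum_sub_distrib]
    refine Finset.sum_congr rfl fun m _ => ?_
    rw [Finset.prod_range_succ]
    have h1 : x⁻¹ * x ^ ((m : ℝ) - k) = x ^ ((m : ℝ) - k - 1) := by
      rw [← rpow_neg_one, ← rpow_add hx0]; ring_nf
    have h2 : x ^ ((m : ℝ) - ((k + 1 : ℕ) : ℝ)) = x ^ ((m : ℝ) - k - 1) := by
      push_cast; ring_nf
    rw [h2]
    calc e m * (∏ l ∈ range k, ((m : ℝ) - 2 * l - 1)) * (((m : ℝ) - k) * x ^ ((m : ℝ) - k - 1))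
          - ((k + 1 : ℕ) : ℝ) * x⁻¹ * (e m * (∏ l ∈ range k, ((m : ℝ) - 2 * l - 1)) * x ^ ((m : ℝ) - k))
        = e m * (∏ l ∈ range k, ((m : ℝ) - 2 * l - 1)) * (((m : ℝ) - k) * x ^ ((m : ℝ) - k - 1))
          - ((k + 1 : ℕ) : ℝ) * (e m * (∏ l ∈ range k, ((m : ℝ) - 2 * l - 1))
            * (x⁻¹ * x ^ ((m : ℝ) - k))) := by ring
      _ = e m * ((∏ l ∈ range k, ((m : ℝ) - 2 * l - 1)) * ((m : ℝ) - 2 * k - 1))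
          * x ^ ((m : ℝ) - k - 1) := by rw [h1]; push_cast; ring

/-- The ladder coefficient `Π_{l<n}(m − 2l − 1)` vanishes for odd `m ≤ 2n − 1`. [folklore] -/
theorem ladder_coeff_eq_zero_of_odd {m n : ℕ} (hm : Odd m) (hmn : m < 2 * n) :
    (∏ l ∈ range n, ((m : ℝ) - 2 * l - 1)) = 0 := by
  obtain ⟨l, rfl⟩ := hm
  refine Finset.prod_eq_zero (i := l) (mem_range.2 (by omega)) ?_
  push_cast; ring

/-- A Taylor polynomial `Σ_{m≤N} d_m (x−1)^m` is a power sum `Σ_{m≤N} e_m x^m`. [folklore] -/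
theorem taylorSum_eq_powerSum (d : ℕ → ℝ) (N : ℕ) :
    ∃ e : ℕ → ℝ, ∀ x : ℝ,
      ∑ m ∈ range (N + 1), d m * (x - 1) ^ m = ∑ m ∈ range (N + 1), e m * x ^ m := by
  set p : ℝ[X] := ∑ m ∈ range (N + 1), C (d m) * (X - C 1) ^ m with hp
  have hdeg : p.natDegree < N + 1 := by
    refine Nat.lt_succ_of_le (natDegree_sum_le_of_forall_le _ _ fun m hm => ?_)
    calc (C (d m) * (X - C 1) ^ m).natDegree
        ≤ (C (d m)).natDegree + ((X - C (1:ℝ)) ^ m).natDegree := natDegree_mul_le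
      _ ≤ 0 + m * (X - C (1:ℝ)).natDegree := add_le_add (natDegree_C _).le natDegree_pow_le
      _ ≤ N := by
          rw [natDegree_X_sub_C, zero_add, mul_one]
          exact Nat.lt_succ_iff.1 (mem_range.1 hm)
  refine ⟨fun i => p.coeff i, fun x => ?_⟩
  rw [← eval_eq_sum_range' hdeg x, hp, eval_finsetSum]
  refine Finset.sum_congr rfl fun m _ => ?_
  simp only [eval_mul, eval_C, eval_pow, eval_sub, eval_X]

/-- **`ladder n` of a Taylor polynomial of degree `≤ N ≤ n` is a combination of `x^{m−n}`,
even `m ≤ N` only.** [folklore] -/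
theorem ladder_taylorSum_eq_powerSum (hιeq : ∀ x, 1 / 2 < x → ι x = x⁻¹) (d : ℕ → ℝ) {N n : ℕ}
    (hN : N ≤ n) :
    ∃ α : ℕ → ℝ, (∀ m, Odd m → α m = 0) ∧ ∀ x, 1 / 2 < x →
      ladder ι n (fun z => ∑ m ∈ range (N + 1), d m * (z - 1) ^ m) x
        = ∑ m ∈ range (N + 1), α m * x ^ ((m : ℝ) - n) := by
  obtain ⟨e, he⟩ := taylorSum_eq_powerSum d N
  have hfun : (fun z => ∑ m ∈ range (N + 1), d m * (z - 1) ^ m)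
      = fun z => ∑ m ∈ range (N + 1), e m * z ^ m := funext he
  refine ⟨fun m => if Odd m then 0 else e m * ∏ l ∈ range n, ((m : ℝ) - 2 * l - 1),
    fun m hm => by simp [hm], fun x hx => ?_⟩
  rw [hfun, ladder_powerSum hιeq e N n x hx]
  refine Finset.sum_congr rfl fun m hm => ?_
  by_cases hmo : Odd m
  · have hm2 : m < 2 * n := by
      have := mem_range.1 hm
      rcases hmo with ⟨l, rfl⟩
      omega
    simp [hmo, ladder_coeff_eq_zero_of_odd hmo hm2]
  · simp [hmo]

end Literature.Analysis.ODE
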